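import Literature.MathematicalPhysics.QuantumFieldTheory.Balaban1983to89.B9SectCDiffCutModel

/-!
# `Balaban1983to89.B9SectCDiffCutModelToy` — NON-VACUITY of the geometric half of `CutModel`: the cutoff facts and
one `OpLoc` record INHABITED on a one-level block line with a ramp cutoff, and the defect `[h, Q′] ∈ 𝒵(0, 1/M)` by
`opZon_of_geom` (item (T1) of the cell brief `b2b-balaban-r1/g13/BRIEF-gen14.md`, census `SectC-inst-census.md` §6(a′))

B9 = T. Bałaban, *Propagators for lattice gauge theories in a background field*, Commun. Math. Phys. **99**, 389–434
(1985) [Balaban1985BackgroundPropagators]; [4] = B6 = T. Bałaban, *Propagators and renormalization transformations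
for lattice gauge theories. II*, Commun. Math. Phys. **96**, 223–250 (1984) [Balaban1984PropagatorsII]; B5 = part I,
Commun. Math. Phys. **95**, 17–40 (1984) [Balaban1984PropagatorsI].

CITATION HEADER (lean-in-tree rule 2026-08-18).  Cell `pub-balaban`, unit `b2b-balaban-r1-g14` (READER GROUP A,
lineage r1, gen 14), journal claim `SECTC-DIFF-CUTMODEL-TOY`.  Source: doi:10.1007/bf01240355, held
`paper:balaban1985-cmp99-background-propagators`, journal page = PDF page + 388; the sentences this toy makes
quantitative are quoted VERBATIM in `…B9SectCDiffCutModel`'s header (p. 414 [PDF 26]: *"They are of the order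
O(M⁻¹), or O(M⁻²), if considered on a proper scale."* and (3.102); p. 412 [PDF 24]: *"the distance from □̃ to □̃₀ᶜ
is at least M (on L^{−j}-scale)"*; p. 393 (3.19): the block averaging `Q′`), read as images by gen 13 of this
lineage; NOT re-read by this unit (no new quotation is introduced here).  Tree inputs (by name):
`B9SectCDiffCutModel.{OpConst, OpLoc, opZon_of_geom, cutX_id_id}`, `B9SectCDiffEstimate.{Frame, Frame.Valid, OpZon,
BlkMaj, WDec, RowZone, Transfer}`, `B9SectCDiff.{tdef, cutX}`, `B6DomainMajorant.{zoneDepth, isDepth_zoneDepth,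
zoneDepth_eq_zero, le_zoneDepth}`, `B4Sect5Torus.IsPseudoDist`.  Cell rows: GAPS G-B9-05R residual (iv), C-r1g13-1,
this module's row C-r1g14-1; census `b2b-balaban-r1/SectC-inst-census.md` §3/§5 D6/§6(a′).  Mathlib otherwise.  No
`HarnessLib` fact, no named-fact `Prop`, no hypothesis structure introduced; no `sorry`.

## WHAT THIS MODULE DOES

`…B9SectCDiffCutModel` reduces hypothesis (L) of THEOREM D to a CUT MODEL: ONE cutoff function `h` with three
cutoff facts (`modulus` on the proper scale, `zone`, `far`) and h-free `OpLoc` records of the local operators; its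
dictionary `opZon_of_geom` turns (modulus × range, zone × locality, block row sums) into a zone class `𝒵(k, ω₀rc)`.
All of these are HYPOTHESIS shapes; before this module nothing in the tree inhabited them with a non-constant `h`.
Here, on the simplest honest geometry —
* §1 the ONE-LEVEL BLOCK LINE: `n` blocks of `B` sites, sites `Fin n × Fin B` (block index, offset), positions
  `pos (I, o) = I·B + o` (lattice spacing `1`), distance `dE = |pos − pos′|`, the proper scale `sc ≡ B` (= `Lʲη` at
  one level), the block frame `lineFrame` (`ρ(I, J) = |I − J|` in block units, depth `β = zoneDepth ρ N` to a zone
  `N`, `K ≡ 1`, rate `δ₀`, `u = δ₀/20`, `Λ = 1`) and its `Frame.Valid` (`lineFrame_valid`: at one level the scale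
  transfer (2.60) is trivial);
* §2 the RAMP CUTOFF `h = clamp((pos − I₀B)/(MB), 0, 1)` rising over `M` blocks from block `I₀` (the profile of
  `h_□` across the boundary layer of width `M` of p. 412, in one dimension): `ramp_modulus` — the proper-scale
  modulus `|h(e) − h(e′)| ≤ (1/M)·B⁻¹·dE(e, e′)` for ALL pairs (`ω₀ = 1/M`); `ramp_zone` — within radius `ℓ = B`,
  `h(e) ≠ h(e′)` forces the block of `e` into the ramp zone `N = {I₀ − 1 ≤ I ≤ I₀ + M}` (depth `0`); `ramp_far` —
  `h ≡ 0` within radius `B` of every block left of `I₀ − 2` (the shape of `CutModel.farS₁` for the window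
  `{I ≥ I₀ − 2}`);
* §3 the BLOCK AVERAGING `Q′(I, (J, o)) = B⁻¹·[J = I]` ((3.19) at one level, unit weights): `opLoc_Qp` — the h-free
  record `OpLoc … 0 ⟨1, 1, 1⟩ Q′ …` (range `≤ 1·sc¹`, locality `≤ B`, block row sums `≤ 1·sc⁰·e^{−δ₀ρ}`) INHABITED;
* §4 THE DEFECT IN THE ZONE CLASS: `defect_opZon` — by `opZon_of_geom`, `𝔇(Q′) = diag(h∘x_S)·Q′ − Q′·diag(h) =
  [h, Q′] ∈ 𝒵(0, 1/M)` in `lineFrame`; unfolded (`defect_rowsum_le`, `defect_eq_zero_off_zone`): every block row sum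
  of `|(h(I,0) − h(y))·Q′(I, y)|` is `≤ (1/M)·e^{−δ₀|I−J|}` and the defect VANISHES at rows outside `N` — the printed
  *"O(M⁻¹) … on a proper scale"* as a kernel number on this geometry; and SHARPNESS (`defect_rowsum_mid`): at a block
  inside the ramp the diagonal block row sum EQUALS `(B − 1)/(2MB)` (`defect_rowsum_mid_ge`: `≥ 1/(4M)` for `B ≥ 2`),
  so the class constant is of exact order `M⁻¹` here;
* §5 the windowed presentation: with the proper coarse window `{I ≥ I₀ − 2}` the far-row hypothesis `hfarL` of
  `opZon_of_geom` is DISCHARGED from `ramp_far` + locality exactly as in `CutModel.zQ'_raw` (`defect_opZon_window`).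

## WHAT IS NOT CLAIMED (ABSOLUTE RULE)

Nothing printed is asserted.  This is a TOY: one level (constant scale), one dimension, abelian unit weights, ONE
operator (`Q′`) and ONE sequence (`T₁ = T₂`), so the two-sequence content of `CutModel` (agreement on the cutoff
support only, matched windows of two different block structures) and the Leibniz block are NOT exercised, and no
operator of B9 on Balaban's multiscale geometry `{Ω_n(□)}` is shown to satisfy anything (census D1/D2/D6 remain
MISSING).  Value = non-vacuity certificate of the hypothesis shapes `OpLoc` / `modulus` / `zone` / `far` /
`Frame.Valid` with a non-constant cutoff and the first kernel instance of an `O(M⁻¹)` zone constant, NOT summit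
progress.
-/

namespace Literature.MathematicalPhysics.QuantumFieldTheory.Balaban1983to89.B9SectCDiffCutModelToy

open Finset Real
open B4Sect5Torus (IsPseudoDist)
open B6DomainChange (IsDepth)
open B6DomainMajorant (zoneDepth isDepth_zoneDepth zoneDepth_eq_zero le_zoneDepth)
open B9SectCDiffEstimate
open B9SectCDiffCutModel
open B9SectCDiff (tdef cutX)

/-! ## §1 The one-level block line and its frame -/

section Line

variable {n B : ℕ}

/-- position of a fine site `(I, o)` (block index, offset) on the line with lattice spacing `1`: `I·B + o`.
OURS (typing). [folklore] -/
def pos (n B : ℕ) (e : Fin n × Fin B) : ℝ := (e.1 : ℝ) * B + (e.2 : ℝ)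

/-- distance of positions. OURS (typing). [folklore] -/
def dE (n B : ℕ) (e e' : Fin n × Fin B) : ℝ := |pos n B e - pos n B e'|

/-- block distance in block units (the one-level proper-scale distance). OURS (typing). [folklore] -/
def bdist (n : ℕ) (I J : Fin n) : ℝ := |(I : ℝ) - (J : ℝ)|

/-- [folklore] -/
theorem bdist_isPseudoDist (n : ℕ) : IsPseudoDist (bdist n) where
  symm I J := abs_sub_comm _ _
  zero I := by simp [bdist]
  triangle I J K := abs_sub_le _ _ _

/-- [folklore] -/
theorem bdist_nonneg (I J : Fin n) : 0 ≤ bdist n I J := abs_nonneg _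

/-- [folklore] -/
theorem bdist_self (I : Fin n) : bdist n I I = 0 := (bdist_isPseudoDist n).zero I

/-- distinct blocks are at block distance `≥ 1`. [folklore] -/
theorem one_le_bdist {I J : Fin n} (h : I ≠ J) : 1 ≤ bdist n I J := by
  unfold bdist
  have hne : (I : ℤ) ≠ (J : ℤ) := fun h' => h (Fin.ext (by exact_mod_cast h'))
  rcases lt_or_gt_of_ne hne with hlt | hlt
  · have : (I : ℝ) + 1 ≤ (J : ℝ) := by exact_mod_cast hlt
    rw [abs_of_nonpos (by linarith)]; linarith
  · have : (J : ℝ) + 1 ≤ (I : ℝ) := by exact_mod_cast hlt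
    rw [abs_of_nonneg (by linarith)]; linarith

/-- **THE ONE-LEVEL BLOCK FRAME** on the blocks `Fin n` of the line: `ρ = bdist` (block units), depth `β =
zoneDepth ρ N` to a zone `N`, profile `K ≡ 1`, proper scale `sc ≡ B`, rate `δ₀`, unit loss `u = δ₀/20`, `Λ = 1`.
OURS (typing). [folklore] -/
noncomputable def lineFrame (n B : ℕ) (N : Finset (Fin n)) (hN : N.Nonempty) (δ₀ : ℝ) : Frame (Fin n) where
  ρ := bdist n
  β := zoneDepth (bdist n) N hN
  K := fun _ => 1
  sc := fun _ => (B : ℝ)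
  δ₀ := δ₀
  u := δ₀ / 20
  Λ := 1

variable {N : Finset (Fin n)} {hN : N.Nonempty} {δ₀ : ℝ}

/-- [folklore] -/ @[simp] theorem lineFrame_ρ : (lineFrame n B N hN δ₀).ρ = bdist n := rfl
/-- [folklore] -/ @[simp] theorem lineFrame_β : (lineFrame n B N hN δ₀).β = zoneDepth (bdist n) N hN := rfl
/-- [folklore] -/ @[simp] theorem lineFrame_sc (I : Fin n) : (lineFrame n B N hN δ₀).sc I = (B : ℝ) := rfl
/-- [folklore] -/ @[simp] theorem lineFrame_δ₀ : (lineFrame n B N hN δ₀).δ₀ = δ₀ := rfl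
/-- [folklore] -/ @[simp] theorem lineFrame_K (a : ℝ) : (lineFrame n B N hN δ₀).K a = 1 := rfl
/-- [folklore] -/ @[simp] theorem lineFrame_u : (lineFrame n B N hN δ₀).u = δ₀ / 20 := rfl
/-- [folklore] -/ @[simp] theorem lineFrame_Λ : (lineFrame n B N hN δ₀).Λ = 1 := rfl

/-- **`Frame.Valid` OF THE BLOCK FRAME** for `B ≥ 1`, `δ₀ > 0`: at one level (constant scale) the transfer (2.60)
holds with `Λ = 1` at any tilt; `20u = δ₀`. [folklore] -/
theorem lineFrame_valid (hB : 0 < B) (hN : N.Nonempty) (hδ₀ : 0 < δ₀) : (lineFrame n B N hN δ₀).Valid where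
  hρ := bdist_isPseudoDist n
  hβ := isDepth_zoneDepth (bdist_isPseudoDist n) N hN
  hK a _ := zero_le_one
  hsc I := by show (0 : ℝ) < B; exact_mod_cast hB
  htr k _ _ := by
    intro I J
    show (B : ℝ) ^ k ≤ 1 * (B : ℝ) ^ k * Real.exp (δ₀ / 20 * bdist n I J)
    rw [one_mul]
    exact le_mul_of_one_le_right (zpow_nonneg (Nat.cast_nonneg B) k)
      (Real.one_le_exp (mul_nonneg (by linarith) (bdist_nonneg I J)))
  hu := by show 0 < δ₀ / 20; linarith
  hΛ := le_refl _
  hKu := le_refl _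
  hδ₀ := by show 20 * (δ₀ / 20) ≤ δ₀; linarith

/-- a block outside the zone has depth `≥ 1` (distinct blocks are `≥ 1` apart). [folklore] -/
theorem one_le_depth_of_not_mem {I : Fin n} (hI : I ∉ N) : 1 ≤ zoneDepth (bdist n) N hN I :=
  le_zoneDepth (bdist n) hN fun _ hJ => one_le_bdist fun h => hI (h ▸ hJ)

end Line

/-! ## §2 The ramp cutoff over `M` blocks: modulus `1/M` on the proper scale, zone, far -/

section Ramp

variable {n B M I₀ : ℕ}

/-- the ramp profile `clamp((x − I₀B)/(MB), 0, 1)`. OURS (typing). [folklore] -/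
noncomputable def ramp (B M I₀ : ℕ) (x : ℝ) : ℝ := max 0 (min 1 ((x - I₀ * B) / (M * B)))

/-- THE RAMP CUTOFF on the fine sites. OURS (typing). [folklore] -/
noncomputable def hcut (n B M I₀ : ℕ) (e : Fin n × Fin B) : ℝ := ramp B M I₀ (pos n B e)

/-- [folklore] -/
theorem ramp_nonneg (x : ℝ) : 0 ≤ ramp B M I₀ x := le_max_left _ _

/-- [folklore] -/
theorem ramp_le_one (x : ℝ) : ramp B M I₀ x ≤ 1 :=
  max_le zero_le_one (min_le_left _ _)

/-- left of the ramp the cutoff is `0`. [folklore] -/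
theorem ramp_eq_zero_of_le (hB : 0 < B) (hM : 0 < M) {x : ℝ} (hx : x ≤ I₀ * B) : ramp B M I₀ x = 0 := by
  unfold ramp
  have hMB : (0 : ℝ) < M * B := by positivity
  have h1 : (x - I₀ * B) / (M * B) ≤ 0 := div_nonpos_of_nonpos_of_nonneg (by linarith) hMB.le
  rw [max_eq_left]
  exact le_trans (min_le_right _ _) h1

/-- right of the ramp the cutoff is `1`. [folklore] -/
theorem ramp_eq_one_of_ge (hB : 0 < B) (hM : 0 < M) {x : ℝ} (hx : (I₀ + M : ℝ) * B ≤ x) : ramp B M I₀ x = 1 := by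
  unfold ramp
  have hMB : (0 : ℝ) < M * B := by positivity
  have h1 : 1 ≤ (x - I₀ * B) / (M * B) := by
    rw [le_div_iff₀ hMB]; linarith
  rw [min_eq_left h1, max_eq_right zero_le_one]

/-- the clamp is `1`-Lipschitz, so the ramp has slope `≤ 1/(MB)`: **the proper-scale modulus with `ω₀ = 1/M`**,
for ALL pairs of positions. [folklore] -/
theorem ramp_lipschitz (hB : 0 < B) (hM : 0 < M) (x x' : ℝ) :
    |ramp B M I₀ x - ramp B M I₀ x'| ≤ (1 / M) * (B : ℝ)⁻¹ * |x - x'| := by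
  unfold ramp
  have hMB : (0 : ℝ) < M * B := by positivity
  calc |max 0 (min 1 ((x - I₀ * B) / (M * B))) - max 0 (min 1 ((x' - I₀ * B) / (M * B)))|
      ≤ max |(0 : ℝ) - 0| |min 1 ((x - I₀ * B) / (M * B)) - min 1 ((x' - I₀ * B) / (M * B))| :=
        abs_max_sub_max_le_max _ _ _ _
    _ = |min 1 ((x - I₀ * B) / (M * B)) - min 1 ((x' - I₀ * B) / (M * B))| := by
        rw [sub_zero, abs_zero, max_eq_right (abs_nonneg _)]
    _ ≤ max |(1 : ℝ) - 1| |(x - I₀ * B) / (M * B) - (x' - I₀ * B) / (M * B)| :=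
        abs_min_sub_min_le_max _ _ _ _
    _ = |(x - I₀ * B) / (M * B) - (x' - I₀ * B) / (M * B)| := by
        rw [sub_self, abs_zero, max_eq_right (abs_nonneg _)]
    _ = (1 / M) * (B : ℝ)⁻¹ * |x - x'| := by
        rw [← sub_div, abs_div, abs_of_pos hMB]
        have : x - ↑I₀ * ↑B - (x' - ↑I₀ * ↑B) = x - x' := by ring
        rw [this]
        field_simp

/-- **CUTOFF FACT 1 (`CutModel.modulus` shape) INHABITED**: `|h(e) − h(e′)| ≤ ω₀·sc(blk e)⁻¹·dE(e, e′)` with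
`ω₀ = 1/M`, `sc ≡ B`, for all pairs (a fortiori within any radius). [folklore] -/
theorem ramp_modulus (hB : 0 < B) (hM : 0 < M) {N : Finset (Fin n)} {hN : N.Nonempty} {δ₀ : ℝ}
    (ℓ : Fin n × Fin B → ℝ) :
    ∀ e e', dE n B e e' ≤ ℓ e → |hcut n B M I₀ e - hcut n B M I₀ e'| ≤
      (1 / M) * ((lineFrame n B N hN δ₀).sc (id (Prod.fst e)))⁻¹ * dE n B e e' :=
  fun _ _ _ => ramp_lipschitz hB hM _ _

/-- where the ramp varies: if `h(x) ≠ h(x′)` and `|x − x′| ≤ B` then `x ∈ ((I₀ − 1)B, (I₀ + M + 1)B)`. [folklore] -/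
theorem ramp_ne_window (hB : 0 < B) (hM : 0 < M) {x x' : ℝ} (hne : ramp B M I₀ x ≠ ramp B M I₀ x')
    (hd : |x - x'| ≤ B) : (I₀ : ℝ) * B - B < x ∧ x < (I₀ + M : ℝ) * B + B := by
  have hd' := abs_le.1 hd
  constructor
  · by_contra hle
    push Not at hle
    have hB0 : (0 : ℝ) ≤ B := Nat.cast_nonneg B
    have hx : ramp B M I₀ x = 0 := ramp_eq_zero_of_le hB hM (by linarith)
    have hx' : ramp B M I₀ x' = 0 := ramp_eq_zero_of_le hB hM (by linarith)
    exact hne (hx.trans hx'.symm)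
  · by_contra hle
    push Not at hle
    have hx : ramp B M I₀ x = 1 := ramp_eq_one_of_ge hB hM (by linarith)
    have hx' : ramp B M I₀ x' = 1 := ramp_eq_one_of_ge hB hM (by linarith)
    exact hne (hx.trans hx'.symm)

/-- THE RAMP ZONE: the blocks `I₀ − 1 ≤ I ≤ I₀ + M` (written without truncated subtraction). OURS (typing).
[folklore] -/
def rampZone (n M I₀ : ℕ) : Finset (Fin n) := univ.filter fun I => I₀ ≤ I.val + 1 ∧ I.val ≤ I₀ + M

/-- [folklore] -/
theorem mem_rampZone {I : Fin n} : I ∈ rampZone n M I₀ ↔ I₀ ≤ I.val + 1 ∧ I.val ≤ I₀ + M := by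
  simp [rampZone]

/-- the ramp zone contains block `I₀` (so it is non-empty when `I₀ < n`). [folklore] -/
theorem rampZone_nonempty (hI₀ : I₀ < n) : (rampZone n M I₀).Nonempty :=
  ⟨⟨I₀, hI₀⟩, mem_rampZone.2 ⟨Nat.le_succ _, Nat.le_add_right _ _⟩⟩

/-- the block of a position: `I·B ≤ pos (I, o) < (I + 1)·B`. [folklore] -/
theorem pos_bounds (e : Fin n × Fin B) : (e.1 : ℝ) * B ≤ pos n B e ∧ pos n B e < ((e.1 : ℝ) + 1) * B := by
  have h0 : (0 : ℝ) ≤ (e.2 : ℕ) := Nat.cast_nonneg _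
  have h1 : ((e.2 : ℕ) : ℝ) < B := by exact_mod_cast e.2.isLt
  unfold pos
  constructor <;> linarith

/-- a position in `((I₀ − 1)B, (I₀ + M + 1)B)` lies in a block of the ramp zone. [folklore] -/
theorem mem_rampZone_of_window (hB : 0 < B) {e : Fin n × Fin B} (h1 : (I₀ : ℝ) * B - B < pos n B e)
    (h2 : pos n B e < (I₀ + M : ℝ) * B + B) : e.1 ∈ rampZone n M I₀ := by
  obtain ⟨hl, hu⟩ := pos_bounds e
  have hB' : (0 : ℝ) < B := by exact_mod_cast hB
  rw [mem_rampZone]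
  constructor
  · by_contra hc
    push Not at hc
    have hc' : (e.1.val : ℝ) + 1 + 1 ≤ I₀ := by exact_mod_cast hc
    have : ((e.1 : ℝ) + 1) * B ≤ (I₀ : ℝ) * B - B := by nlinarith
    linarith
  · by_contra hc
    push Not at hc
    have hc' : (I₀ : ℝ) + M + 1 ≤ (e.1.val : ℝ) := by exact_mod_cast hc
    have : (I₀ + M : ℝ) * B + B ≤ (e.1 : ℝ) * B := by nlinarith
    linarith

/-- **CUTOFF FACT 2 (`CutModel.zone` shape) INHABITED**: within radius `ℓ ≡ B`, `h(e) ≠ h(e′)` forces the block of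
`e` into the ramp zone, where the depth `β = zoneDepth` vanishes. [folklore] -/
theorem ramp_zone (hB : 0 < B) (hM : 0 < M) (hN : (rampZone n M I₀).Nonempty) {δ₀ : ℝ} :
    ∀ e e', dE n B e e' ≤ (fun _ => (B : ℝ)) e → hcut n B M I₀ e ≠ hcut n B M I₀ e' →
      (lineFrame n B (rampZone n M I₀) hN δ₀).β (id (Prod.fst e)) = 0 := by
  intro e e' hd hne
  obtain ⟨h1, h2⟩ := ramp_ne_window hB hM hne hd
  exact zoneDepth_eq_zero (bdist_isPseudoDist n) hN (mem_rampZone_of_window hB h1 h2)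

/-- **CUTOFF FACT 3 (`CutModel.farS₁` shape) INHABITED** for the coarse window `{I : I₀ ≤ I + 2}`: `h ≡ 0` within
radius `B` of the position `(I, 0)` of every block `I` left of the window. [folklore] -/
theorem ramp_far (hB : 0 < B) (hM : 0 < M) (I : Fin n) (hI : ¬ I₀ ≤ I.val + 2) (o₀ : Fin B) (ho₀ : o₀.val = 0) :
    ∀ e', dE n B (I, o₀) e' ≤ (fun _ => (B : ℝ)) (I, o₀) → hcut n B M I₀ e' = 0 := by
  intro e' hd
  have hd' := (abs_le.1 hd).1
  have hI' : (I.val : ℝ) + 2 + 1 ≤ I₀ := by exact_mod_cast Nat.lt_of_not_le hI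
  have hp : pos n B (I, o₀) = (I.val : ℝ) * B := by simp [pos, ho₀]
  have hB' : (0 : ℝ) < B := by exact_mod_cast hB
  refine ramp_eq_zero_of_le hB hM ?_
  unfold dE at hd
  have : pos n B e' ≤ pos n B (I, o₀) + B := by linarith [(abs_le.1 hd).1, (abs_le.1 hd).2]
  rw [hp] at this
  nlinarith

end Ramp

/-! ## §3 The block averaging `Q′` of (3.19) at one level: the h-free `OpLoc` record INHABITED -/

section Averaging

variable {n B : ℕ}

/-- the one-level block averaging with unit weights: `Q′(I, (J, o)) = B⁻¹·[J = I]`. OURS (typing).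
[cite: Balaban1985BackgroundPropagators, (3.19) p.393] -/
noncomputable def Qp (n B : ℕ) : Matrix (Fin n) (Fin n × Fin B) ℝ := fun I y => if y.1 = I then (B : ℝ)⁻¹ else 0

/-- [folklore] -/
theorem Qp_ne_zero {I : Fin n} {y : Fin n × Fin B} (h : Qp n B I y ≠ 0) : y.1 = I := by
  by_contra hc; exact h (by simp [Qp, hc])

/-- the coarse position of block `I`: its left end `(I, 0)`. OURS (typing). [folklore] -/
def xS (hB : 0 < B) (I : Fin n) : Fin n × Fin B := (I, ⟨0, hB⟩)

/-- [folklore] -/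
theorem pos_xS (hB : 0 < B) (I : Fin n) : pos n B (xS hB I) = (I : ℝ) * B := by simp [pos, xS]

/-- within its block a site is at distance `≤ B − 1 < B` from the block's left end. [folklore] -/
theorem dE_xS_of_fst_eq (hB : 0 < B) {I : Fin n} {y : Fin n × Fin B} (hy : y.1 = I) :
    dE n B (xS hB I) y ≤ (B : ℝ) - 1 := by
  unfold dE
  rw [pos_xS]
  have h0 : (0 : ℝ) ≤ (y.2 : ℕ) := Nat.cast_nonneg _
  have h1 : ((y.2 : ℕ) : ℝ) + 1 ≤ B := by exact_mod_cast y.2.isLt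
  have : pos n B y = (I : ℝ) * B + (y.2 : ℕ) := by simp [pos, hy]
  rw [this, abs_le]; constructor <;> linarith

/-- the block row sums of `Q′`: `Σ_{y ∈ block J} |Q′(I, y)| = [J = I]`. [folklore] -/
theorem Qp_rowsum (hB : 0 < B) (I J : Fin n) :
    ∑ y ∈ univ.filter (fun y : Fin n × Fin B => y.1 = J), |Qp n B I y| = if J = I then 1 else 0 := by
  rw [sum_filter, Fintype.sum_prod_type]
  simp only [Qp]
  rw [Finset.sum_eq_single J]
  · simp only [if_true]
    by_cases hJ : J = I
    · rw [if_pos hJ]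
      have hB' : (B : ℝ) ≠ 0 := by exact_mod_cast hB.ne'
      simp only [hJ, if_true, abs_inv, Nat.abs_cast, sum_const, card_univ, Fintype.card_fin, nsmul_eq_mul]
      exact mul_inv_cancel₀ hB'
    · rw [if_neg hJ]; simp [hJ]
  · intro K _ hK; simp [hK]
  · intro h; exact absurd (mem_univ J) h

variable {N : Finset (Fin n)} {hN : N.Nonempty} {δ₀ : ℝ}

/-- **THE h-FREE RECORD `OpLoc` INHABITED** by `Q′` in the block frame, class `k = 0`, constants `r = 1` (range
`≤ 1·sc¹` at the row block), `κ = 1`, `c = 1` (block row sums `≤ 1·sc⁰·e^{−δ₀ρ}`), locality radius `ℓ ≡ B`; rows =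
all blocks (window `id`), row positions `(I, 0)`, column positions the sites, row blocks `id`, column blocks
`Prod.fst`. [cite: Balaban1985BackgroundPropagators, (3.19) p.393 + (3.102) p.414] -/
theorem opLoc_Qp (hB : 0 < B) :
    OpLoc (lineFrame n B N hN δ₀) id id (dE n B) (fun _ => (B : ℝ)) 0 ⟨1, 1, 1⟩ (Qp n B) id (xS hB) id id
      Prod.fst where
  r_nonneg := zero_le_one
  c_nonneg := zero_le_one
  rng a y _ hT := by
    have h := dE_xS_of_fst_eq hB (Qp_ne_zero hT)
    simp only [id_eq] at h
    show dE n B (xS hB a) y ≤ 1 * (B : ℝ) ^ (1 : ℤ)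
    rw [one_mul, zpow_one]
    linarith
  loc a y hT := by
    have h := dE_xS_of_fst_eq hB (Qp_ne_zero hT)
    simp only [id_eq] at h
    show dE n B (xS hB a) y ≤ (B : ℝ)
    linarith
  maj a J _ := by
    show ∑ y ∈ univ.filter (fun y : Fin n × Fin B => y.1 = J), |Qp n B (id a) y| ≤
      1 * (B : ℝ) ^ ((0 : ℤ) + 1 - 1) * Real.exp (-(δ₀ * bdist n (id a) (id J)))
    rw [id, Qp_rowsum hB, show ((0 : ℤ) + 1 - 1) = 0 by norm_num, zpow_zero, one_mul, one_mul]
    by_cases hJ : J = a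
    · rw [if_pos hJ, hJ]; simp [bdist_self]
    · rw [if_neg hJ]; exact Real.exp_nonneg _

end Averaging

/-! ## §4 The defect `[h, Q′]` in the zone class `𝒵(0, 1/M)` by `opZon_of_geom`, unfolded, and its sharpness -/

section Defect

variable {n B M I₀ : ℕ} {δ₀ : ℝ}

/-- THE DEFECT `𝔇(Q′) = diag(h ∘ x_S)·Q′ − Q′·diag(h)` of the one-sequence toy (both members `Q′`):
the commutator of the cutoff with the block averaging. OURS (typing).
[cite: Balaban1985BackgroundPropagators, (3.102) p.414] -/
noncomputable def defect (n B M I₀ : ℕ) (hB : 0 < B) : Matrix (Fin n) (Fin n × Fin B) ℝ :=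
  tdef (Matrix.diagonal fun I => hcut n B M I₀ (xS hB I)) (Matrix.diagonal (hcut n B M I₀)) (Qp n B) (Qp n B)

/-- entrywise: `𝔇(Q′)(I, y) = (h(I, 0) − h(y))·Q′(I, y)`. [folklore] -/
theorem defect_apply (hB : 0 < B) (I : Fin n) (y : Fin n × Fin B) :
    defect n B M I₀ hB I y = (hcut n B M I₀ (xS hB I) - hcut n B M I₀ y) * Qp n B I y := by
  unfold defect
  rw [B9SectCDiff.tdef_def, Matrix.sub_apply, Matrix.diagonal_mul, Matrix.mul_diagonal]
  ring

/-- **THE DEFECT IN THE ZONE CLASS**: for `B ≥ 1`, `M ≥ 1`, `I₀ < n`, `δ₀ > 0`, in the block frame with zone =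
the ramp zone, `𝔇(Q′) ∈ 𝒵(0, (1/M)·1·1)` — `opZon_of_geom` fed with the INHABITED modulus (`ω₀ = 1/M`), zone,
`OpLoc` record, trivial agreement (`T₁ = T₂`) and vacuous far rows (all blocks are window rows). OURS.
[cite: Balaban1985BackgroundPropagators, (3.102) p.414 + p.412] -/
theorem defect_opZon' (hB : 0 < B) (hM : 0 < M) (hI₀ : I₀ < n) (hδ₀ : 0 < δ₀) :
    OpZon (lineFrame n B (rampZone n M I₀) (rampZone_nonempty hI₀) δ₀) id Prod.fst id id 0 ((1 / M) * 1 * 1)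
      (tdef (cutX id id fun I => hcut n B M I₀ (xS hB I)) (cutX id id (hcut n B M I₀)) (Qp n B) (Qp n B)) :=
  opZon_of_geom (F := lineFrame n B (rampZone n M I₀) (rampZone_nonempty hI₀) δ₀) (bu := id) (bv := Prod.fst)
    (p₁ := id) (p₂ := id) (T₁ := Qp n B) (T₂ := Qp n B) (f₁ := id) (f₂ := id) (e₁ := id) (e₂ := id)
    (ψ := fun I => hcut n B M I₀ (xS hB I)) (χ := hcut n B M I₀) (h := hcut n B M I₀) (blk := Prod.fst)
    (xr := xS hB) (xc := id) (br := id) (o := ⟨1, 1, 1⟩)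
    (lineFrame_valid hB _ hδ₀) Function.injective_id Function.injective_id (fun _ => rfl) (fun _ => rfl)
    (fun _ => rfl) (fun _ => rfl) (ramp_modulus hB hM _) (by positivity) (ramp_zone hB hM _)
    (opLoc_Qp hB) (fun _ _ _ => rfl) (fun _ t ht => absurd ⟨t, rfl⟩ ht) (fun s _ hs => absurd ⟨s, rfl⟩ hs)

/-- **`[h, Q′] ∈ 𝒵(0, 1/M)`** on the one-level block line (diagonal presentation, constant `1/M`).  The first
kernel instance of p. 414's *"O(M⁻¹) … on a proper scale"*. OURS.
[cite: Balaban1985BackgroundPropagators, (3.102) p.414 + p.412] -/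
theorem defect_opZon (hB : 0 < B) (hM : 0 < M) (hI₀ : I₀ < n) (hδ₀ : 0 < δ₀) :
    OpZon (lineFrame n B (rampZone n M I₀) (rampZone_nonempty hI₀) δ₀) id Prod.fst id id 0 (1 / M)
      (defect n B M I₀ hB) := by
  have h := defect_opZon' hB hM hI₀ hδ₀
  rw [cutX_id_id, cutX_id_id, mul_one, mul_one] at h
  exact h

/-- **UNFOLDED**: every block row sum of the defect is `≤ (1/M)·e^{−δ₀|I − J|}`. OURS.
[cite: Balaban1985BackgroundPropagators, p.414] -/
theorem defect_rowsum_le (hB : 0 < B) (hM : 0 < M) (hI₀ : I₀ < n) (hδ₀ : 0 < δ₀) (I J : Fin n) :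
    ∑ y ∈ univ.filter (fun y : Fin n × Fin B => y.1 = J), |defect n B M I₀ hB I y| ≤
      (1 / M) * Real.exp (-(δ₀ * bdist n I J)) := by
  obtain ⟨K, hK, hW, _⟩ := defect_opZon hB hM hI₀ hδ₀
  have h1 := hK.le I J
  have h2 := hW I J
  simp only [lineFrame_ρ, lineFrame_sc, zpow_zero, mul_one, Frame.rate_zero, lineFrame_δ₀, id] at h2
  exact h1.trans ((le_abs_self _).trans h2)

/-- **UNFOLDED**: the defect VANISHES at every row outside the ramp zone (there `β ≥ 1`, and the majorant's rows
live where `β = 0`). OURS. [cite: Balaban1985BackgroundPropagators, p.412] -/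
theorem defect_eq_zero_off_zone (hB : 0 < B) (hM : 0 < M) (hI₀ : I₀ < n) (hδ₀ : 0 < δ₀) {I : Fin n}
    (hI : I ∉ rampZone n M I₀) (y : Fin n × Fin B) : defect n B M I₀ hB I y = 0 := by
  obtain ⟨K, hK, _, hR⟩ := defect_opZon hB hM hI₀ hδ₀
  have hβ : (lineFrame n B (rampZone n M I₀) (rampZone_nonempty hI₀) δ₀).β (id I) ≠ 0 := by
    rw [lineFrame_β, id]
    exact ne_of_gt (lt_of_lt_of_le one_pos (one_le_depth_of_not_mem hI))
  have hKI : K I y.1 = 0 := by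
    by_contra hc; exact hβ (hR I y.1 hc)
  have hsum := hK.le I y.1
  simp only [id_eq, hKI] at hsum
  have hy : y ∈ univ.filter (fun y' : Fin n × Fin B => y'.1 = y.1) := mem_filter.2 ⟨mem_univ _, rfl⟩
  have := (sum_eq_zero_iff_of_nonneg fun _ _ => abs_nonneg _).1
    (le_antisymm hsum (sum_nonneg fun _ _ => abs_nonneg _)) y hy
  exact abs_eq_zero.1 this

/-- inside the ramp the cutoff is the linear profile: `h(x) = (x − I₀B)/(MB)` for `I₀B ≤ x ≤ (I₀ + M)B`.
[folklore] -/
theorem ramp_eq_of_mem (hB : 0 < B) (hM : 0 < M) {x : ℝ} (h1 : (I₀ : ℝ) * B ≤ x) (h2 : x ≤ (I₀ + M : ℝ) * B) :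
    ramp B M I₀ x = (x - I₀ * B) / (M * B) := by
  unfold ramp
  have hMB : (0 : ℝ) < M * B := by positivity
  have hlo : 0 ≤ (x - I₀ * B) / (M * B) := div_nonneg (by linarith) hMB.le
  have hhi : (x - I₀ * B) / (M * B) ≤ 1 := by rw [div_le_one hMB]; linarith
  rw [min_eq_right hhi, max_eq_right hlo]

/-- **SHARPNESS**: at a block `I` inside the ramp (`I₀ ≤ I`, `I + 1 ≤ I₀ + M`) the diagonal block row sum of the
defect EQUALS `(B − 1)/(2MB)` — the zone constant is of exact order `M⁻¹` on this geometry. OURS.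
[cite: Balaban1985BackgroundPropagators, p.414] -/
theorem defect_rowsum_mid (hB : 0 < B) (hM : 0 < M) {I : Fin n} (hI1 : I₀ ≤ I.val) (hI2 : I.val + 1 ≤ I₀ + M) :
    ∑ y ∈ univ.filter (fun y : Fin n × Fin B => y.1 = I), |defect n B M I₀ hB I y| =
      ((B : ℝ) - 1) / (2 * M * B) := by
  have hB' : (0 : ℝ) < B := by exact_mod_cast hB
  have hM' : (0 : ℝ) < M := by exact_mod_cast hM
  have hMB : (0 : ℝ) < M * B := by positivity
  have hI1' : (I₀ : ℝ) ≤ I.val := by exact_mod_cast hI1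
  have hI2' : (I.val : ℝ) + 1 ≤ I₀ + M := by exact_mod_cast hI2
  -- the cutoff values on block I
  have hval : ∀ o : Fin B, hcut n B M I₀ (I, o) = (((I : ℝ) - I₀) * B + o) / (M * B) := by
    intro o
    have h0 : (0 : ℝ) ≤ (o : ℕ) := Nat.cast_nonneg _
    have h1 : ((o : ℕ) : ℝ) + 1 ≤ B := by exact_mod_cast o.isLt
    unfold hcut
    rw [ramp_eq_of_mem hB hM]
    · simp only [pos]; ring
    · simp only [pos]; nlinarith
    · simp only [pos]; nlinarith
  have hrow : ∀ o : Fin B, |defect n B M I₀ hB I (I, o)| = (o : ℕ) / (M * B * B) := by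
    intro o
    have h0 : (0 : ℝ) ≤ (o : ℕ) := Nat.cast_nonneg _
    rw [defect_apply, xS, hval, hval]
    simp only [Qp, if_true, Nat.cast_zero, add_zero]
    rw [abs_mul, abs_inv, Nat.abs_cast, ← sub_div, abs_div, abs_of_pos hMB]
    have : ((I : ℝ) - I₀) * B - (((I : ℝ) - I₀) * B + o) = -o := by ring
    rw [this, abs_neg, abs_of_nonneg h0]
    field_simp
  rw [sum_filter, Fintype.sum_prod_type, Finset.sum_eq_single I]
  · simp only [if_true]
    rw [Finset.sum_congr rfl fun o _ => hrow o, ← Finset.sum_div, Fin.sum_univ_eq_sum_range (fun i => (i : ℝ)) B]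
    have hsum : ∑ i ∈ Finset.range B, (i : ℝ) = (B : ℝ) * (B - 1) / 2 := by
      have hB1 : 1 ≤ B := hB
      have h := congrArg (fun m : ℕ => (m : ℝ)) (Finset.sum_range_id_mul_two B)
      push_cast [Nat.cast_sub hB1] at h
      linarith
    rw [hsum]
    field_simp
  · intro K _ hK; simp [hK]
  · intro h; exact absurd (mem_univ I) h

/-- hence for `B ≥ 2` the mid-ramp diagonal block row sum is `≥ 1/(4M)`: no zone constant `o(M⁻¹)` is possible
on this geometry. OURS. [cite: Balaban1985BackgroundPropagators, p.414] -/
theorem defect_rowsum_mid_ge (hB : 0 < B) (hB2 : 2 ≤ B) (hM : 0 < M) {I : Fin n} (hI1 : I₀ ≤ I.val)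
    (hI2 : I.val + 1 ≤ I₀ + M) :
    1 / (4 * (M : ℝ)) ≤ ∑ y ∈ univ.filter (fun y : Fin n × Fin B => y.1 = I), |defect n B M I₀ hB I y| := by
  rw [defect_rowsum_mid hB hM hI1 hI2]
  have hB' : (2 : ℝ) ≤ B := by exact_mod_cast hB2
  have hM' : (0 : ℝ) < M := by exact_mod_cast hM
  rw [div_le_div_iff₀ (by positivity) (by positivity)]
  nlinarith

end Defect

/-! ## §5 The windowed presentation: the far-row hypothesis DISCHARGED from `ramp_far` + locality -/

section Window

variable {n B M I₀ : ℕ} {δ₀ : ℝ}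

/-- the proper coarse window: blocks `I` with `I₀ ≤ I + 2` (everything from two blocks left of the ramp on).
OURS (typing). [folklore] -/
def Win (n I₀ : ℕ) : Type := {I : Fin n // I₀ ≤ I.val + 2}

/-- [folklore] -/
instance : Fintype (Win n I₀) := by unfold Win; infer_instance

/-- **THE DEFECT IN THE ZONE CLASS, WINDOWED PRESENTATION**: the coarse cutoff presented through the window
`Win ↪ Fin n` (`cutX val val (h ∘ x_S ∘ val)`), the far-row hypothesis `hfarL` of `opZon_of_geom` discharged from
CUTOFF FACT 3 (`ramp_far`) and the h-free locality of `Q′` by `mul_h_eq_zero_of_far` — the pattern of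
`CutModel.zQ'_raw`, here with every input INHABITED. OURS.
[cite: Balaban1985BackgroundPropagators, (3.102) p.414 + p.412] -/
theorem defect_opZon_window (hB : 0 < B) (hM : 0 < M) (hI₀ : I₀ < n) (hδ₀ : 0 < δ₀) :
    OpZon (lineFrame n B (rampZone n M I₀) (rampZone_nonempty hI₀) δ₀) id Prod.fst id id 0 ((1 / M) * 1 * 1)
      (tdef (cutX (Subtype.val : Win n I₀ → Fin n) Subtype.val fun u => hcut n B M I₀ (xS hB u.val))
        (cutX id id (hcut n B M I₀)) (Qp n B) (Qp n B)) := by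
  have hop := opLoc_Qp (N := rampZone n M I₀) (hN := rampZone_nonempty hI₀) (δ₀ := δ₀) hB
  -- the record along the window rows (a sub-family of rows inherits the record)
  have hopW : OpLoc (lineFrame n B (rampZone n M I₀) (rampZone_nonempty hI₀) δ₀) id id (dE n B)
      (fun _ => (B : ℝ)) 0 ⟨1, 1, 1⟩ (Qp n B) (Subtype.val : Win n I₀ → Fin n) (fun u => xS hB u.val) id
      (fun u => u.val) Prod.fst :=
    ⟨hop.r_nonneg, hop.c_nonneg, fun a y hβ hT => hop.rng a.val y hβ hT, fun a y hT => hop.loc a.val y hT,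
      fun a J hβ => hop.maj a.val J hβ⟩
  exact opZon_of_geom (F := lineFrame n B (rampZone n M I₀) (rampZone_nonempty hI₀) δ₀) (bu := id)
    (bv := Prod.fst) (p₁ := id) (p₂ := id) (T₁ := Qp n B) (T₂ := Qp n B)
    (f₁ := (Subtype.val : Win n I₀ → Fin n)) (f₂ := Subtype.val) (e₁ := id) (e₂ := id)
    (ψ := fun u => hcut n B M I₀ (xS hB u.val)) (χ := hcut n B M I₀) (h := hcut n B M I₀) (blk := Prod.fst)
    (xr := fun u => xS hB u.val) (xc := id) (br := fun u => u.val) (o := ⟨1, 1, 1⟩)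
    (lineFrame_valid hB _ hδ₀) Subtype.val_injective Function.injective_id (fun _ => rfl) (fun _ => rfl)
    (fun _ => rfl) (fun _ => rfl) (ramp_modulus hB hM _) (by positivity) (ramp_zone hB hM _) hopW
    (fun _ _ _ => rfl) (fun _ t ht => absurd ⟨t, rfl⟩ ht)
    (fun s v hs => mul_h_eq_zero_of_far (dE := dE n B) (h := hcut n B M I₀) (ℓ := fun _ => (B : ℝ))
      (e₀ := xS hB s) (e' := v) (x := Qp n B s v)
      (ramp_far hB hM s (fun hle => hs ⟨⟨s, hle⟩, rfl⟩) ⟨0, hB⟩ rfl) (fun hT => hop.loc s v hT))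

end Window

end Literature.MathematicalPhysics.QuantumFieldTheory.Balaban1983to89.B9SectCDiffCutModelToy
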